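import Literature.Topology.FourManifolds.SphereFamilySurgery
import Literature.Topology.FourManifolds.CircleSurgeryExistence
import Literature.AlgebraicTopology.SingularHomology.SphereCoreLocalHomology
import Literature.AlgebraicTopology.SingularHomology.MayerVietorisExactness
import Literature.AlgebraicTopology.SingularHomology.ExcisionMayerVietorisProofs
import Literature.AlgebraicTopology.SingularHomology.CollapseMap
import Mathlib.Analysis.Normed.Module.Ball.Homeomorph
import HarnessLib

/-!
# The effect of a surgery on homology below the middle dimension (Kosinski X.1.1)

Topic `Literature/Topology/FourManifolds` (fact seat `provefact-…` of
`Literature.Topology.FourManifolds.HomotopySphere.exists_highlyConnected_of_mem_signatureSet`).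
A. Kosinski, *Differential Manifolds* (1993), Ch. X §1, Prop. (1.1), p. 197: for the surgery
`χ(M, S)` on a framed `(k)`-sphere `S` in an `m`-manifold, *"`Hᵢ χ(M, S) ≅ Hᵢ M` for `i < k`
(`m ≥ 2k + …`) and `H_k χ(M, S) ≅ H_k M / [S]`"* — proof: `M ∖ S ↪ M` is an `Hᵢ`-isomorphism in
low degrees, and the Mayer–Vietoris sequence of `χ = (M ∖ S) ∪ (D^{k+1} × S^l)`.  This file PROVES
the parts of that statement consumed by framed surgery below the middle dimension (X.2.2), in the
relational language of the tree and for Mathlib's singular homology with arbitrary coefficients,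
free of Poincaré duality and Künneth formulas:

Let `ν` be a framed family with ONE sphere (`[Unique ι]`, core `Sᵏ`, fibre `ℝˡ⁺¹`) in a Hausdorff
`X`, and let `P` be glued from `A = X ∖ S` and `B = OD^{k+1} × Sˡ` along Milnor's relation by open
embeddings `jA`, `jB` covering `P` with `jA a = jB b ↔ sphereFamilySurgeryRel ν a b` (unbundled
hypotheses `hA hB hcov hrel` — the topological content of `FramedSphereFamily.IsSurgery` /
`IsOpenGluingWith`, `IsOpenGluingWith.isOpenEmbedding_left_right`).  Then

* `isZero_singularHomology_of_surgery` — for `1 ≤ n ≤ k`, `n < l`: `Hₙ(X) = 0 ⟹ Hₙ(P) = 0`;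
* `epi_map_jA_of_surgery` — for `1 ≤ n ≤ k`, `n < l`: `(jA)_* : Hₙ(X ∖ S) → Hₙ(P)` is onto;
* `isIso_map_complement_val` — `Hₙ(X ∖ S) ≅ Hₙ(X)` for `n < l`
  (`SphereCoreLocalHomology.lean`);
* `map_jA_parallelSphere_eq_zero` — the parallel sphere `u ↦ φ(u, v₀)` (`0 < ‖v₀‖ < 1`), which in
  `X` is homotopic to the core (`map_parallelSphere_eq_map_sphere`), dies in `Hₙ(P)`, `n ≠ 0`
  (it bounds the disc `{‖y‖ ≤ ‖v₀‖} × pt` of the handle);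

so that `H_k(P)` is generated by the images of any set of generators of `H_k(X) ≅ H_k(X ∖ S)`
from which the class of `S` may be omitted — the form in which X.1.1 enters the proof of X.2.2
("we can kill the generators of `H_k` one at a time").  The Mayer–Vietoris inputs (Hatcher 2002,
§2.2) are the tree theorems `mayerVietoris.exact₂_holds`, excision
`isIso_map_of_interior_union_interior_holds` (`…MayerVietorisExactness`, `…ExcisionTheorem`), the
low-codimension isomorphism `isIso_map_subsetIncl_compl_sphereCore` and the vanishing of the
homology of the punctured tube `Sᵏ × (Bˡ⁺¹ ∖ 0)` below `min(k, l)` (both from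
`…SphereCoreLocalHomology`), and the sphere computations `isZero_singularHomology_sphere_holds`.

Everything is proved; the definitions (with bodies) are the subsets / homeomorphisms / maps of the
Mayer–Vietoris cover (`gluedPart`, `puncturedUnitTube`, `gluedPartHomeomorph`,
`ballTimesSphereHomeomorph`, `parallelSphere`, `sphereMap`); no named facts.  Spaces live in
`Type` (Mathlib's `singularHomology.map` relates spaces of one universe and `𝕊 k : Type`).

## References

* A. Kosinski, *Differential Manifolds* (1993), Ch. X §1, Prop. (1.1) (p. 197) and its proof;
  §2, proof of Thm. (2.2) (p. 201). [Kosinski1993]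
* J. Milnor, *Lectures on the h-cobordism theorem* (1965), Def. 3.11. [MilnorHCobordism1965]
* A. Hatcher, *Algebraic Topology* (2002), §2.2 pp. 149–150 (Mayer–Vietoris). [HatcherAT2002]
-/

noncomputable section

open scoped Manifold ContDiff Topology ContinuousMap
open CategoryTheory Limits Set Function Metric Topology
open Literature.AlgebraicTopology.SingularHomology

universe u v

namespace Literature.Topology.FourManifolds

/-- Local notation: `𝔼 n` is the model Euclidean space `EuclideanSpace ℝ (Fin n)`. -/
local notation "𝔼 " n:arg => EuclideanSpace ℝ (Fin n)

/-- Local notation: `𝕊 n` is the unit sphere in `EuclideanSpace ℝ (Fin (n + 1))`. -/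
local notation "𝕊 " n:arg => (Metric.sphere (0 : EuclideanSpace ℝ (Fin (n + 1))) 1)

variable (R : Type v) [CommRing R] (M : Type v) [AddCommGroup M] [Module R M]

/-! ### Two Mayer–Vietoris consequences (Hatcher §2.2), with the tree's exactness theorems -/

section MV

variable {P : Type u} [TopologicalSpace P] (U V : Set P)

/-- If `Hₙ(U ∩ V) → Hₙ(U)` is injective then the Mayer–Vietoris connecting map
`δ : Hₙ₊₁(P) → Hₙ(U ∩ V)` vanishes (`δ ≫ φ = 0` and `φ` is injective).
[cite: HatcherAT2002, §2.2 p. 149] -/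
theorem mayerVietoris_δ_eq_zero_of_mono (hUV : interior U ∪ interior V = univ) (n : ℕ)
    (hmono : Mono (singularHomology.map R M (subsetInclusion (inter_subset_left : U ∩ V ⊆ U)) n)) :
    mayerVietoris.δ R M U V
      (relativeSingularHomology.isIso_map_of_interior_union_interior_holds R M P) hUV n = 0 := by
  have hφ : Mono (mayerVietoris.φ R M U V n) :=
    mono_of_mono_fac (biprod.lift_fst _ _ : mayerVietoris.φ R M U V n ≫ biprod.fst = _)
  exact zero_of_comp_mono (mayerVietoris.φ R M U V n) (mayerVietoris.δ_comp_φ R M U V _ hUV n)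

/-- **Mayer–Vietoris, vanishing criterion**: if `Hₙ₊₁(U) = Hₙ₊₁(V) = 0` and
`Hₙ(U ∩ V) → Hₙ(U)` is injective then `Hₙ₊₁(P) = 0` (Hatcher 2002, §2.2 p. 149; the tree's
`mayerVietoris.isZero_of_mono_inter` with the exactness facts discharged).
[cite: HatcherAT2002, §2.2 p. 149] -/
theorem isZero_of_mayerVietoris_of_mono (hU : IsOpen U) (hV : IsOpen V) (hUV : U ∪ V = univ)
    (n : ℕ) (hU0 : IsZero (singularHomology R M U (n + 1)))
    (hV0 : IsZero (singularHomology R M V (n + 1)))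
    (hmono : Mono (singularHomology.map R M (subsetInclusion (inter_subset_left : U ∩ V ⊆ U)) n)) :
    IsZero (singularHomology R M P (n + 1)) := by
  have hUV' : interior U ∪ interior V = univ := by rw [hU.interior_eq, hV.interior_eq, hUV]
  have hexc := relativeSingularHomology.isIso_map_of_interior_union_interior_holds R M P
  have hδ := mayerVietoris_δ_eq_zero_of_mono R M U V hUV' n hmono
  haveI : Epi (mayerVietoris.ψ R M U V (n + 1)) :=
    (mayerVietoris.exact₂_holds R M U V hexc hUV' n).epi_f hδ
  exact IsZero.of_epi (mayerVietoris.ψ R M U V (n + 1)) ((biprod_isZero_iff _ _).2 ⟨hU0, hV0⟩)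

/-- **Mayer–Vietoris, surjectivity criterion**: if `Hₙ₊₁(V) = 0` and `Hₙ(U ∩ V) → Hₙ(U)` is
injective then `Hₙ₊₁(U) → Hₙ₊₁(P)` is onto (exactness at `Hₙ₊₁(P)`: `ψ` is onto since `δ = 0`,
and its `V`-summand vanishes). [cite: HatcherAT2002, §2.2 p. 149] -/
theorem epi_of_mayerVietoris_of_mono (hU : IsOpen U) (hV : IsOpen V) (hUV : U ∪ V = univ)
    (n : ℕ) (hV0 : IsZero (singularHomology R M V (n + 1)))
    (hmono : Mono (singularHomology.map R M (subsetInclusion (inter_subset_left : U ∩ V ⊆ U)) n)) :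
    Epi (singularHomology.map R M (subsetIncl U) (n + 1)) := by
  have hUV' : interior U ∪ interior V = univ := by rw [hU.interior_eq, hV.interior_eq, hUV]
  have hexc := relativeSingularHomology.isIso_map_of_interior_union_interior_holds R M P
  have hδ := mayerVietoris_δ_eq_zero_of_mono R M U V hUV' n hmono
  haveI hψ : Epi (mayerVietoris.ψ R M U V (n + 1)) :=
    (mayerVietoris.exact₂_holds R M U V hexc hUV' n).epi_f hδ
  have hfac : mayerVietoris.ψ R M U V (n + 1) =
      biprod.fst ≫ singularHomology.map R M (subsetIncl U) (n + 1) := by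
    apply biprod.hom_ext'
    · rw [mayerVietoris.ψ, biprod.inl_desc, biprod.inl_fst_assoc]
    · rw [mayerVietoris.ψ, biprod.inr_desc, biprod.inr_fst_assoc, zero_comp]
      exact hV0.eq_of_src _ _
  rw [hfac] at hψ
  exact epi_of_epi
    (biprod.fst : singularHomology R M U (n + 1) ⊞ singularHomology R M V (n + 1) ⟶ _)
    (singularHomology.map R M (subsetIncl U) (n + 1))

end MV

/-! ### Homology does not see a conjugation by homeomorphisms -/

section Transport

variable {X₁ Y₁ X₂ Y₂ : Type u} [TopologicalSpace X₁] [TopologicalSpace Y₁] [TopologicalSpace X₂]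
  [TopologicalSpace Y₂]

/-- Injectivity on `Hₙ` transfers along a square of maps whose verticals are homeomorphisms.
[folklore] -/
theorem mono_map_of_conj (f : C(X₁, Y₁)) (g : C(X₂, Y₂)) (eX : X₁ ≃ₜ X₂) (eY : Y₁ ≃ₜ Y₂)
    (h : ∀ x, eY (f x) = g (eX x)) (n : ℕ)
    (hf : Mono (singularHomology.map R M f n)) : Mono (singularHomology.map R M g n) := by
  have hsq : singularHomology.map R M g n = (singularHomology.mapIso R M eX n).inv ≫
      singularHomology.map R M f n ≫ (singularHomology.mapIso R M eY n).hom := by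
    rw [singularHomology.mapIso_inv, singularHomology.mapIso_hom, ← singularHomology.map_comp,
      ← singularHomology.map_comp]
    congr 1
    ext x
    change g x = eY (f (eX.symm x))
    rw [h, eX.apply_symm_apply]
  rw [hsq]
  infer_instance

/-- Surjectivity on `Hₙ` transfers along a square of maps whose verticals are homeomorphisms.
[folklore] -/
theorem epi_map_of_conj (f : C(X₁, Y₁)) (g : C(X₂, Y₂)) (eX : X₁ ≃ₜ X₂) (eY : Y₁ ≃ₜ Y₂)
    (h : ∀ x, eY (f x) = g (eX x)) (n : ℕ)
    (hf : Epi (singularHomology.map R M f n)) : Epi (singularHomology.map R M g n) := by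
  have hsq : singularHomology.map R M g n = (singularHomology.mapIso R M eX n).inv ≫
      singularHomology.map R M f n ≫ (singularHomology.mapIso R M eY n).hom := by
    rw [singularHomology.mapIso_inv, singularHomology.mapIso_hom, ← singularHomology.map_comp,
      ← singularHomology.map_comp]
    congr 1
    ext x
    change g x = eY (f (eX.symm x))
    rw [h, eX.apply_symm_apply]
  rw [hsq]
  infer_instance

/-- A map homotopic to a constant map induces `0` on `Hₙ`, `n ≠ 0` (it factors through a point,
whose positive-degree homology vanishes). [cite: HatcherAT2002, Thm. 2.10] -/
theorem map_eq_zero_of_homotopic_const {X Y : Type u} [TopologicalSpace X] [TopologicalSpace Y]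
    (f : C(X, Y)) (y₀ : Y) (h : f.Homotopic (ContinuousMap.const X y₀)) {n : ℕ} (hn : n ≠ 0) :
    singularHomology.map R M f n = 0 := by
  rw [singularHomology.map_eq_of_homotopic R M h]
  have hfac : (ContinuousMap.const X y₀ : C(X, Y)) =
      (ContinuousMap.const PUnit.{u + 1} y₀).comp (ContinuousMap.const X PUnit.unit) := by
    ext; rfl
  rw [hfac, singularHomology.map_comp]
  have h0 : singularHomology.map R M (ContinuousMap.const PUnit.{u + 1} y₀) n = 0 :=
    (isZero_singularHomology_of_subsingleton R M (X := PUnit.{u + 1}) hn).eq_of_src _ _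
  rw [h0, comp_zero]

end Transport

/-! ### The punctured tube and the handle: homology below `min(k, l)` -/

section Pieces

variable {k l : ℕ}

/-- The open unit ball of `ℝˡ⁺¹` punctured at the origin is path-connected for `l ≥ 1` (through the
sphere of radius `½`). [folklore] -/
theorem isPathConnected_puncturedBall (hl : 1 ≤ l) :
    IsPathConnected {w : 𝔼 (l + 1) | w ≠ 0 ∧ ‖w‖ < 1} := by
  have hrank : 1 < Module.rank ℝ (𝔼 (l + 1)) := by
    rw [← Module.finrank_eq_rank, finrank_euclideanSpace, Fintype.card_fin]
    exact_mod_cast (by omega : 1 < l + 1)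
  have hS : IsPathConnected (sphere (0 : 𝔼 (l + 1)) 2⁻¹) :=
    isPathConnected_sphere hrank 0 (by norm_num)
  have hSsub : sphere (0 : 𝔼 (l + 1)) 2⁻¹ ⊆ {w : 𝔼 (l + 1) | w ≠ 0 ∧ ‖w‖ < 1} := by
    intro w hw
    rw [mem_sphere_zero_iff_norm] at hw
    refine ⟨fun h ↦ ?_, by rw [hw]; norm_num⟩
    rw [h, norm_zero] at hw; norm_num at hw
  -- every point is joined to the sphere of radius `½` by a radial segment inside the set
  have hseg : ∀ w ∈ {w : 𝔼 (l + 1) | w ≠ 0 ∧ ‖w‖ < 1},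
      JoinedIn {w : 𝔼 (l + 1) | w ≠ 0 ∧ ‖w‖ < 1} w ((2⁻¹ * ‖w‖⁻¹) • w) := by
    rintro w ⟨hw0, hw1⟩
    have hwpos : 0 < ‖w‖ := norm_pos_iff.2 hw0
    refine JoinedIn.of_segment_subset fun z hz ↦ ?_
    rw [segment_eq_image] at hz
    obtain ⟨t, ⟨ht0, ht1⟩, rfl⟩ := hz
    dsimp only
    have hcoef : (1 - t) • w + t • ((2⁻¹ * ‖w‖⁻¹) • w) = (1 - t + t * (2⁻¹ * ‖w‖⁻¹)) • w := by
      rw [smul_smul, ← add_smul]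
    rw [hcoef]
    have hc : 0 < 1 - t + t * (2⁻¹ * ‖w‖⁻¹) := by
      have : 0 ≤ t * (2⁻¹ * ‖w‖⁻¹) := by positivity
      rcases ht1.lt_or_eq with h | rfl
      · linarith
      · norm_num; positivity
    refine ⟨smul_ne_zero hc.ne' hw0, ?_⟩
    rw [norm_smul, Real.norm_eq_abs, abs_of_pos hc]
    -- `(1 - t) ‖w‖ + t/2 < 1`
    have h1 : (1 - t + t * (2⁻¹ * ‖w‖⁻¹)) * ‖w‖ = (1 - t) * ‖w‖ + t * 2⁻¹ := by
      field_simp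
    rw [h1]
    nlinarith
  refine ⟨(2⁻¹ : ℝ) • EuclideanSpace.single 0 1, ?_, fun w hw ↦ ?_⟩
  · exact hSsub (by simp [norm_smul])
  · have hw' := hseg w hw
    have hmem : (2⁻¹ * ‖w‖⁻¹) • w ∈ sphere (0 : 𝔼 (l + 1)) 2⁻¹ := by
      rw [mem_sphere_zero_iff_norm, norm_smul, Real.norm_eq_abs, abs_of_pos (by
        have := norm_pos_iff.2 hw.1; positivity), mul_assoc,
        inv_mul_cancel₀ (norm_ne_zero_iff.2 hw.1), mul_one]
    have hbase : (2⁻¹ : ℝ) • EuclideanSpace.single (0 : Fin (l + 1)) (1 : ℝ) ∈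
        sphere (0 : 𝔼 (l + 1)) 2⁻¹ := by simp [norm_smul]
    exact ((hS.joinedIn _ hbase _ hmem).mono hSsub).trans hw'.symm

/-- **The punctured unit tube `Sᵏ × (Bˡ⁺¹ ∖ 0)` has no homology in degrees `0 < n < min(k, l)`**:
by `SphereCoreLocalHomology` the inclusion into the full unit tube `Sᵏ × Bˡ⁺¹ ≃ Sᵏ` is an
`Hₙ`-isomorphism for `n + 1 < l + 1`, and `Hₙ(Sᵏ) = 0` for `0 < n < k`.
[cite: Kosinski1993, Ch. X §1, Prop. 1.1] -/
theorem isZero_singularHomology_puncturedTube {n : ℕ} (hn0 : n ≠ 0) (hnk : n < k) (hnl : n < l) :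
    IsZero (singularHomology R M
      ↥{q : (𝕊 k) × (𝔼 (l + 1)) | q.2 ≠ 0 ∧ ‖q.2‖ < 1} n) := by
  -- the unit tube `Y = Sᵏ × B` as a space, with the open embedding `id × unitBall : Sᵏ × ℝˡ⁺¹ ≅ Y`
  let Y : Type := ↥(univ ×ˢ ball (0 : 𝔼 (l + 1)) 1 : Set ((𝕊 k) × (𝔼 (l + 1))))
  let φ : (𝕊 k) × (𝔼 (l + 1)) → Y := fun q ↦
    ⟨(q.1, (Homeomorph.unitBall q.2 : 𝔼 (l + 1))), ⟨mem_univ _, (Homeomorph.unitBall q.2).2⟩⟩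
  let e1 : Y ≃ₜ (𝕊 k) × ball (0 : 𝔼 (l + 1)) 1 :=
    { toFun := fun y ↦ (y.1.1, ⟨y.1.2, y.2.2⟩)
      invFun := fun q ↦ ⟨(q.1, (q.2 : 𝔼 (l + 1))), ⟨mem_univ _, q.2.2⟩⟩
      left_inv := fun _ ↦ rfl
      right_inv := fun _ ↦ rfl
      continuous_toFun := (continuous_fst.comp continuous_subtype_val).prodMk
        ((continuous_snd.comp continuous_subtype_val).subtype_mk _)
      continuous_invFun :=
        (continuous_fst.prodMk (continuous_subtype_val.comp continuous_snd)).subtype_mk _ }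
  have hφhomeo : IsOpenEmbedding φ := by
    let e : ((𝕊 k) × (𝔼 (l + 1))) ≃ₜ Y :=
      ((Homeomorph.refl (𝕊 k)).prodCongr Homeomorph.unitBall).trans e1.symm
    have he : (e : (𝕊 k) × (𝔼 (l + 1)) → Y) = φ := by funext q; rfl
    rw [← he]
    exact e.isOpenEmbedding
  -- its core is `Sᵏ × 0` and the complement of the core is the punctured unit tube
  have hcore : (φ '' (univ ×ˢ {0}))ᶜ = {y : Y | y.1.2 ≠ 0} := by
    ext y
    simp only [mem_compl_iff, mem_setOf_eq]
    constructor
    · intro hy h0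
      apply hy
      refine ⟨(y.1.1, 0), ⟨mem_univ _, rfl⟩, ?_⟩
      apply Subtype.ext
      show ((y.1.1, ((Homeomorph.unitBall (0 : 𝔼 (l + 1)) : ball (0 : 𝔼 (l + 1)) 1) : 𝔼 (l + 1))) :
        (𝕊 k) × (𝔼 (l + 1))) = y.1
      rw [Homeomorph.coe_unitBall_apply_zero]
      exact Prod.ext rfl h0.symm
    · rintro hy ⟨⟨u, w⟩, ⟨-, hw⟩, rfl⟩
      rw [mem_singleton_iff] at hw
      subst hw
      exact hy Homeomorph.coe_unitBall_apply_zero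
  haveI hiso := isIso_map_subsetIncl_compl_sphereCore R M hφhomeo (i := n) (by omega)
  -- `Hₙ(Y ∖ core) ≅ Hₙ(Y) ≅ Hₙ(Sᵏ) = 0`
  have hY : IsZero (singularHomology R M Y n) := by
    haveI : ContractibleSpace (ball (0 : 𝔼 (l + 1)) 1) :=
      (convex_ball (0 : 𝔼 (l + 1)) 1).contractibleSpace ⟨0, mem_ball_self one_pos⟩
    obtain ⟨hv⟩ := ContractibleSpace.hequiv_unit (ball (0 : 𝔼 (l + 1)) 1)
    have e2 : ((𝕊 k) × ball (0 : 𝔼 (l + 1)) 1) ≃ₕ ((𝕊 k) × Unit) :=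
      (ContinuousMap.HomotopyEquiv.refl _).prodCongr hv
    have e3 : ((𝕊 k) × Unit) ≃ₜ (𝕊 k) := Homeomorph.prodPUnit _
    refine IsZero.of_iso (isZero_singularHomology_sphere_holds R M hn0 hnk.ne) ?_
    exact singularHomology.mapIso R M e1 n ≪≫ singularHomology.isoOfHomotopyEquiv R M e2 n ≪≫
      singularHomology.mapIso R M e3 n
  have hZ : IsZero (singularHomology R M ↥((φ '' (univ ×ˢ {0}))ᶜ) n) :=
    IsZero.of_iso hY (asIso (singularHomology.map R M (subsetIncl (φ '' (univ ×ˢ {0}))ᶜ) n))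
  -- the punctured unit tube is homeomorphic to `Y ∖ core`
  rw [hcore] at hZ
  refine hZ.of_iso (singularHomology.mapIso R M ?_ n)
  exact
    { toFun := fun q ↦ ⟨⟨q.1, ⟨mem_univ _, mem_ball_zero_iff.2 q.2.2⟩⟩, q.2.1⟩
      invFun := fun y ↦ ⟨y.1.1, ⟨y.2, mem_ball_zero_iff.1 y.1.2.2⟩⟩
      left_inv := fun _ ↦ rfl
      right_inv := fun _ ↦ rfl
      continuous_toFun := (continuous_subtype_val.subtype_mk _).subtype_mk _
      continuous_invFun := (continuous_subtype_val.comp continuous_subtype_val).subtype_mk _ }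

/-- **The handle `OD^{k+1} × Sˡ` has no homology in degrees `0 < n ≠ l`** (it is homotopy
equivalent to `Sˡ`). [cite: HatcherAT2002, Cor. 2.14] -/
theorem isZero_singularHomology_ballProdSphere {n : ℕ} (hn0 : n ≠ 0) (hnl : n ≠ l) :
    IsZero (singularHomology R M (↥(ball (0 : 𝔼 (k + 1)) 1) × (𝕊 l)) n) := by
  haveI : ContractibleSpace (ball (0 : 𝔼 (k + 1)) 1) :=
    (convex_ball (0 : 𝔼 (k + 1)) 1).contractibleSpace ⟨0, mem_ball_self one_pos⟩
  obtain ⟨hv⟩ := ContractibleSpace.hequiv_unit (ball (0 : 𝔼 (k + 1)) 1)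
  have e2 : (↥(ball (0 : 𝔼 (k + 1)) 1) × (𝕊 l)) ≃ₕ (Unit × (𝕊 l)) :=
    hv.prodCongr (ContinuousMap.HomotopyEquiv.refl _)
  have e3 : (Unit × (𝕊 l)) ≃ₜ (𝕊 l) := Homeomorph.punitProd _
  exact IsZero.of_iso (isZero_singularHomology_sphere_holds R M hn0 hnl)
    (singularHomology.isoOfHomotopyEquiv R M e2 n ≪≫ singularHomology.mapIso R M e3 n)

end Pieces

/-! ### A single-sphere surgery gluing: the Mayer–Vietoris cover of `P` -/

section Gluing

/-! Spaces live in `Type` (universe `0`): Mathlib's `singularHomology.map` relates spaces of one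
universe, and the spheres `𝕊 k` live in `Type`; this is the universe of the tree's homotopy
spheres and null-cobordisms. -/

variable {EX HX : Type*} [NormedAddCommGroup EX] [NormedSpace ℝ EX] [TopologicalSpace HX]
  {IX : ModelWithCorners ℝ EX HX} {X : Type} [TopologicalSpace X] [ChartedSpace HX X] [T2Space X]
  {ι : Type} [Unique ι] {k l : ℕ} (ν : FramedSphereFamily IX X ι k (l + 1))
  {P : Type} [TopologicalSpace P] {jA : ↥ν.complement → P} {jB : ↥(ballTimesSphere ι k l) → P}

omit [Unique ι] in
/-- In a one-element index type every index manifold point is the default one. [folklore] -/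
theorem DiscreteIndex.eq_mk_default [Unique ι] (j : DiscreteIndex ι) :
    j = DiscreteIndex.mk default :=
  calc j = DiscreteIndex.mk (DiscreteIndex.mk.symm j) := (Equiv.apply_symm_apply _ _).symm
    _ = DiscreteIndex.mk default := congrArg _ (Subsingleton.elim _ _)

namespace FramedSphereFamily

omit [T2Space X] [Unique ι] in
/-- Each tube of a framed family is an open embedding (any model). [folklore] -/
theorem isOpenEmbedding_toFun (i : ι) : IsOpenEmbedding (ν.toFun i) :=
  ⟨(ν.isSmoothEmbedding i).isEmbedding, ν.isOpen_range i⟩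

/-- The punctured unit tube `Sᵏ × (Bˡ⁺¹ ∖ 0)` as a subset of `Sᵏ × ℝˡ⁺¹`. [folklore] -/
def puncturedUnitTube (k l : ℕ) : Set ((𝕊 k) × (𝔼 (l + 1))) := {q | q.2 ≠ 0 ∧ ‖q.2‖ < 1}

/-- The part of `X ∖ core` glued to the handle: the punctured unit tube `φ(Sᵏ × (Bˡ⁺¹ ∖ 0))` of the
(unique) sphere of the family, seen in `X ∖ core`. [folklore] -/
def gluedPart : Set ↥ν.complement := {a | (a : X) ∈ ν.toFun default '' puncturedUnitTube k l}

/-- Membership in the glued part. [folklore] -/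
theorem mem_gluedPart_iff (a : ↥ν.complement) :
    a ∈ ν.gluedPart ↔ (a : X) ∈ ν.toFun default '' puncturedUnitTube k l := Iff.rfl

/-- `φᵢ q ∈ X ∖ core` for `q` in the punctured unit tube. [folklore] -/
theorem apply_mem_complement_of_mem (i : ι) {q : (𝕊 k) × (𝔼 (l + 1))}
    (hq : q ∈ puncturedUnitTube k l) : ν.toFun i q ∈ ν.complement :=
  ν.apply_mem_complement i q.1 hq.1

/-- **The glued part is homeomorphic to the punctured unit tube** `Sᵏ × (Bˡ⁺¹ ∖ 0)` (through the
framing `φ`). [folklore] -/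
def gluedPartHomeomorph : ↥(puncturedUnitTube k l) ≃ₜ ↥ν.gluedPart :=
  ((ν.isOpenEmbedding_toFun default).isEmbedding.homeomorphImage (puncturedUnitTube k l)).trans
    { toFun := fun x ↦ ⟨⟨x.1, x.2.choose_spec.2 ▸
          ν.apply_mem_complement_of_mem default x.2.choose_spec.1⟩, x.2⟩
      invFun := fun a ↦ ⟨(a.1 : X), a.2⟩
      left_inv := fun _ ↦ rfl
      right_inv := fun _ ↦ rfl
      continuous_toFun := (continuous_subtype_val.subtype_mk _).subtype_mk _
      continuous_invFun := (continuous_subtype_val.comp continuous_subtype_val).subtype_mk _ }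

omit [T2Space X] [Unique ι] in
/-- The punctured unit tube is path-connected for `k, l ≥ 1`. [folklore] -/
theorem isPathConnected_puncturedUnitTube (hk : 1 ≤ k) (hl : 1 ≤ l) :
    IsPathConnected (puncturedUnitTube k l) := by
  haveI := pathConnectedSpace_sphere (n := k) (by omega)
  have h : puncturedUnitTube k l = (univ : Set (𝕊 k)) ×ˢ {w : 𝔼 (l + 1) | w ≠ 0 ∧ ‖w‖ < 1} := by
    ext q; simp [puncturedUnitTube]
  rw [h]
  exact isPathConnected_univ.prod (isPathConnected_puncturedBall hl)

/-- **`Hₘ(glued part) → Hₘ(X ∖ core)` is injective for `m < min(k, l)`**: in degree `0` because the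
glued part is path-connected, in degrees `0 < m < min(k, l)` because its homology vanishes there
(`isZero_singularHomology_puncturedTube`). [cite: Kosinski1993, Ch. X §1, Prop. 1.1] -/
theorem mono_map_gluedPart_val {m : ℕ} (hmk : m < k) (hml : m < l) :
    Mono (singularHomology.map R M (subsetIncl ν.gluedPart) m) := by
  rcases Nat.eq_zero_or_pos m with rfl | hm
  · haveI : PathConnectedSpace ↥(puncturedUnitTube k l) :=
      isPathConnected_iff_pathConnectedSpace.1
        (isPathConnected_puncturedUnitTube (by omega) (by omega))
    haveI : PathConnectedSpace ↥ν.gluedPart :=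
      ν.gluedPartHomeomorph.surjective.pathConnectedSpace ν.gluedPartHomeomorph.continuous
    exact singularHomology.mono_map_zero_of_pathConnectedSpace R M _
  · have hZ : IsZero (singularHomology R M ↥ν.gluedPart m) :=
      (isZero_singularHomology_puncturedTube R M hm.ne' hmk hml).of_iso
        (singularHomology.mapIso R M ν.gluedPartHomeomorph.symm m)
    exact ⟨fun g g' _ ↦ hZ.eq_of_tgt g g'⟩

/-- **The handle `ι × OD^{k+1} × Sˡ` of a one-sphere family is `OD^{k+1} × Sˡ`.** [folklore] -/
def ballTimesSphereHomeomorph (ι : Type) [Unique ι] (k l : ℕ) :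
    ↥(ballTimesSphere ι k l) ≃ₜ (↥(ball (0 : 𝔼 (k + 1)) 1) × (𝕊 l)) where
  toFun b := (⟨b.1.2.1, mem_ball_zero_iff.2 b.2⟩, b.1.2.2)
  invFun q := ⟨(DiscreteIndex.mk default, ((q.1 : 𝔼 (k + 1)), q.2)), mem_ball_zero_iff.1 q.1.2⟩
  left_inv b := by
    apply Subtype.ext
    show (DiscreteIndex.mk default, ((b.1.2.1 : 𝔼 (k + 1)), b.1.2.2)) = b.1
    rw [← DiscreteIndex.eq_mk_default b.1.1]
  right_inv _ := rfl
  continuous_toFun :=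
    ((continuous_fst.comp (continuous_snd.comp continuous_subtype_val)).subtype_mk _).prodMk
      (continuous_snd.comp (continuous_snd.comp continuous_subtype_val))
  continuous_invFun := (continuous_const.prodMk ((continuous_subtype_val.comp continuous_fst).prodMk
    continuous_snd)).subtype_mk _

/-- `Hₙ` of the handle of a one-sphere family vanishes for `0 < n ≠ l`.
[cite: HatcherAT2002, Cor. 2.14] -/
theorem isZero_singularHomology_ballTimesSphere (ι : Type) [Unique ι] {n : ℕ} (hn0 : n ≠ 0)
    (hnl : n ≠ l) : IsZero (singularHomology R M ↥(ballTimesSphere ι k l) n) :=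
  (isZero_singularHomology_ballProdSphere R M hn0 hnl).of_iso
    (singularHomology.mapIso R M (ballTimesSphereHomeomorph ι k l) n)

/-- The complement of the cores of a one-sphere family is the complement of the core of its tube.
[folklore] -/
theorem coe_complement_eq : (ν.complement : Set X) = (ν.toFun default '' (univ ×ˢ {0}))ᶜ := by
  ext x
  change x ∉ ν.cores ↔ x ∈ (ν.toFun default '' (univ ×ˢ {0}))ᶜ
  rw [mem_compl_iff, not_iff_not, mem_cores_iff]
  constructor
  · rintro ⟨i, v, rfl⟩
    rw [Subsingleton.elim i default]
    exact ⟨(v, 0), ⟨mem_univ _, rfl⟩, rfl⟩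
  · rintro ⟨⟨v, w⟩, ⟨-, hw⟩, rfl⟩
    rw [mem_singleton_iff] at hw
    subst hw
    exact ⟨default, v, rfl⟩

/-- **`Hₙ(X ∖ core) ≅ Hₙ(X)` for `n + 1 < l + 1`** (the inclusion; `SphereCoreLocalHomology`).
[cite: Kosinski1993, Ch. X §1, Prop. 1.1] -/
theorem isIso_map_complement_val {n : ℕ} (hn : n < l) :
    IsIso (singularHomology.map R M (subsetIncl (ν.complement : Set X)) n) := by
  have h := isIso_map_subsetIncl_compl_sphereCore R M (ν.isOpenEmbedding_toFun default) (i := n)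
    (c := l + 1) (by omega)
  rw [← coe_complement_eq] at h
  exact h

variable {ν}

omit [TopologicalSpace P] in
/-- `range jA ∩ range jB = jA(glued part)` for a one-sphere surgery gluing. [folklore] -/
theorem range_inter_range_eq (hrel : ∀ a b, jA a = jB b ↔ sphereFamilySurgeryRel ν a b) :
    range jA ∩ range jB = jA '' ν.gluedPart := by
  ext p
  constructor
  · rintro ⟨⟨a, rfl⟩, ⟨b, hb⟩⟩
    obtain ⟨v, θ, hθ, hy, ha⟩ := (hrel a b).1 hb.symm
    refine ⟨a, ?_, rfl⟩
    rw [mem_gluedPart_iff, ha, Subsingleton.elim (DiscreteIndex.mk.symm _) default]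
    refine ⟨_, ⟨?_, ?_⟩, rfl⟩
    · exact smul_ne_zero hθ.1.ne' (ne_zero_of_mem_unit_sphere _)
    · show ‖θ • ((b : DiscreteIndex ι × ((𝔼 (k + 1)) × (𝕊 l))).2.2 : 𝔼 (l + 1))‖ < 1
      rw [norm_smul_coe_sphere hθ.1.le]; exact hθ.2
  · rintro ⟨a, ha, rfl⟩
    refine ⟨mem_range_self a, ?_⟩
    obtain ⟨⟨u, w⟩, ⟨hw0, hw1⟩, hx⟩ := ha
    let b : ↥(ballTimesSphere ι k l) := ⟨(DiscreteIndex.mk default,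
      (‖w‖ • (u : 𝔼 (k + 1)), radialProjection (spherePt l) w)), by
        rw [mem_ballTimesSphere_iff, norm_smul_coe_sphere (norm_nonneg _)]; exact hw1⟩
    refine ⟨b, ((hrel a b).2 ⟨u, ‖w‖, ⟨norm_pos_iff.2 hw0, hw1⟩, rfl, ?_⟩).symm⟩
    show (a : X) = ν.toFun (DiscreteIndex.mk.symm (DiscreteIndex.mk default))
      (u, ‖w‖ • (radialProjection (spherePt l) w : 𝔼 (l + 1)))
    rw [norm_smul_coe_radialProjection, ← hx]
    rfl

variable (hA : IsOpenEmbedding jA) (hB : IsOpenEmbedding jB) (hcov : range jA ∪ range jB = univ)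
  (hrel : ∀ a b, jA a = jB b ↔ sphereFamilySurgeryRel ν a b)

include hA hrel in
/-- `Hₘ(range jA ∩ range jB) → Hₘ(range jA)` is injective for `m < min(k, l)` (transport of
`mono_map_gluedPart_val` along `jA`). [cite: Kosinski1993, Ch. X §1, Prop. 1.1] -/
theorem mono_map_inter {m : ℕ} (hmk : m < k) (hml : m < l) :
    Mono (singularHomology.map R M
      (subsetInclusion (inter_subset_left : range jA ∩ range jB ⊆ range jA)) m) := by
  let eUV : ↥ν.gluedPart ≃ₜ ↥(range jA ∩ range jB) :=
    (hA.isEmbedding.homeomorphImage ν.gluedPart).trans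
      (Homeomorph.setCongr (range_inter_range_eq hrel).symm)
  exact mono_map_of_conj R M (subsetIncl ν.gluedPart) _ eUV hA.isEmbedding.toHomeomorph
    (fun _ ↦ rfl) m (ν.mono_map_gluedPart_val R M hmk hml)

include hA hB hcov hrel in
/-- **Surgery below the middle dimension does not create homology** (Kosinski 1993, X.1,
Prop. (1.1): `Hₙ χ(M, S) ≅ Hₙ M` for `n < k`; here the vanishing half): for a one-sphere surgery
gluing `P = jA(X ∖ S) ∪ jB(OD^{k+1} × Sˡ)` and `1 ≤ m + 1 ≤ k`, `m + 1 < l`,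
`Hₘ₊₁(X; M) = 0 ⟹ Hₘ₊₁(P; M) = 0` (Mayer–Vietoris: `Hₘ₊₁(X ∖ S) ≅ Hₘ₊₁(X) = 0`,
`Hₘ₊₁(OD × Sˡ) = 0`, and `Hₘ(glued part) → Hₘ(X ∖ S)` injective).
[cite: Kosinski1993, Ch. X §1, Prop. 1.1] -/
theorem isZero_singularHomology_of_surgery {m : ℕ} (hmk : m < k) (hml : m + 1 < l)
    (hX : IsZero (singularHomology R M X (m + 1))) : IsZero (singularHomology R M P (m + 1)) := by
  haveI := ν.isIso_map_complement_val R M (n := m + 1) hml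
  have hU : IsZero (singularHomology R M ↥(range jA) (m + 1)) :=
    (hX.of_iso (asIso
      (singularHomology.map R M (subsetIncl (ν.complement : Set X)) (m + 1)))).of_iso
      (singularHomology.mapIso R M hA.isEmbedding.toHomeomorph.symm (m + 1))
  have hV : IsZero (singularHomology R M ↥(range jB) (m + 1)) :=
    (isZero_singularHomology_ballTimesSphere R M ι (Nat.succ_ne_zero m) (by omega)).of_iso
      (singularHomology.mapIso R M hB.isEmbedding.toHomeomorph.symm (m + 1))
  exact isZero_of_mayerVietoris_of_mono R M (range jA) (range jB) hA.isOpen_range hB.isOpen_range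
    hcov m hU hV (mono_map_inter R M hA hrel hmk (by omega))

include hA hB hcov hrel in
/-- **`(jA)_* : Hₘ₊₁(X ∖ S) → Hₘ₊₁(P)` is onto** for `m < k`, `m + 1 < l` (Kosinski 1993, X.1,
Prop. (1.1): `H_k χ(M, S)` is a quotient of `H_k(M ∖ S) ≅ H_k M`).
[cite: Kosinski1993, Ch. X §1, Prop. 1.1] -/
theorem epi_map_jA_of_surgery {m : ℕ} (hmk : m < k) (hml : m + 1 < l) :
    Epi (singularHomology.map R M ⟨jA, hA.continuous⟩ (m + 1)) := by
  have hV : IsZero (singularHomology R M ↥(range jB) (m + 1)) :=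
    (isZero_singularHomology_ballTimesSphere R M ι (Nat.succ_ne_zero m) (by omega)).of_iso
      (singularHomology.mapIso R M hB.isEmbedding.toHomeomorph.symm (m + 1))
  have h := epi_of_mayerVietoris_of_mono R M (range jA) (range jB) hA.isOpen_range hB.isOpen_range
    hcov m hV (mono_map_inter R M hA hrel hmk (by omega))
  exact epi_map_of_conj R M (subsetIncl (range jA)) ⟨jA, hA.continuous⟩
    hA.isEmbedding.toHomeomorph.symm (Homeomorph.refl P)
    (fun x ↦ by
      obtain ⟨x, rfl⟩ := hA.isEmbedding.toHomeomorph.surjective x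
      rw [Homeomorph.symm_apply_apply]; rfl) (m + 1) h

/-! ### The parallel sphere dies in `P` -/

variable (ν) in
/-- **The parallel sphere** `u ↦ φ(u, v₀)` (`v₀ ≠ 0`) of the (unique) framed sphere, a map
`Sᵏ → X ∖ core` (Kosinski 1993, X.1: `S` pushed off itself along the framing).
[cite: Kosinski1993, Ch. X §1, Prop. 1.1] -/
def parallelSphere {v₀ : 𝔼 (l + 1)} (hv₀ : v₀ ≠ 0) : C(𝕊 k, ↥ν.complement) where
  toFun u := ⟨ν.toFun default (u, v₀), ν.apply_mem_complement default u hv₀⟩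
  continuous_toFun := by
    have h : Continuous fun u : 𝕊 k ↦ ν.toFun default (u, v₀) :=
      (ν.continuous default).comp (Continuous.prodMk continuous_id continuous_const)
    exact h.subtype_mk _

variable (ν) in
/-- The core sphere `u ↦ φ(u, 0)` as a continuous map `Sᵏ → X`. [folklore] -/
def sphereMap : C(𝕊 k, X) := ⟨ν.sphere default, ν.continuous_sphere default⟩

/-- **In `X` the parallel sphere is homotopic to the core** (slide along the framing,
`(t, u) ↦ φ(u, t • v₀)`), hence induces the same map on homology.
[cite: Kosinski1993, Ch. X §1, Prop. 1.1] -/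
theorem map_parallelSphere_eq_map_sphere {v₀ : 𝔼 (l + 1)} (hv₀ : v₀ ≠ 0) (n : ℕ) :
    singularHomology.map R M ((subsetIncl (ν.complement : Set X)).comp (ν.parallelSphere hv₀)) n =
      singularHomology.map R M ν.sphereMap n := by
  symm
  refine singularHomology.map_eq_of_homotopic R M ⟨?_⟩ n
  exact
    { toFun := fun p ↦ ν.toFun default (p.2, (p.1 : ℝ) • v₀)
      continuous_toFun := (ν.continuous default).comp (continuous_snd.prodMk
        ((continuous_subtype_val.comp continuous_fst).smul continuous_const))
      map_zero_left := fun u ↦ by simp; rfl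
      map_one_left := fun u ↦ by simp; rfl }

include hrel in
/-- **The parallel sphere dies in `Hₙ(P)`, `n ≠ 0`**: in `P` it is the sphere
`{‖y‖ = ‖v₀‖} × pt` of the handle (`‖v₀‖ < 1`), which contracts onto the centre of the disc it
bounds (Kosinski 1993, X.1, Prop. (1.1): the class `[S]` is killed by the surgery).
[cite: Kosinski1993, Ch. X §1, Prop. 1.1] -/
theorem map_jA_parallelSphere_eq_zero (hBc : Continuous jB) (hAc : Continuous jA) {v₀ : 𝔼 (l + 1)}
    (hv₀ : v₀ ≠ 0) (hv₁ : ‖v₀‖ < 1) {n : ℕ} (hn : n ≠ 0) :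
    singularHomology.map R M ((⟨jA, hAc⟩ : C(_, P)).comp (ν.parallelSphere hv₀)) n = 0 := by
  -- the corresponding sphere in the handle and its contraction
  let b : C(𝕊 k, ↥(ballTimesSphere ι k l)) :=
    { toFun := fun u ↦ ⟨(DiscreteIndex.mk default,
        (‖v₀‖ • (u : 𝔼 (k + 1)), radialProjection (spherePt l) v₀)), by
          rw [mem_ballTimesSphere_iff, norm_smul_coe_sphere (norm_nonneg _)]; exact hv₁⟩
      continuous_toFun := by
        have h1 : Continuous fun u : 𝕊 k ↦ ‖v₀‖ • (u : 𝔼 (k + 1)) := by fun_prop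
        have h2 : Continuous fun u : 𝕊 k ↦ (DiscreteIndex.mk (default : ι),
            (‖v₀‖ • (u : 𝔼 (k + 1)), radialProjection (spherePt l) v₀)) :=
          Continuous.prodMk continuous_const (Continuous.prodMk h1 continuous_const)
        exact h2.subtype_mk _ }
  have hfac : (⟨jA, hAc⟩ : C(_, P)).comp (ν.parallelSphere hv₀) = (⟨jB, hBc⟩ : C(_, P)).comp b := by
    ext u
    show jA (ν.parallelSphere hv₀ u) = jB (b u)
    refine (hrel _ _).2 ⟨u, ‖v₀‖, ⟨norm_pos_iff.2 hv₀, hv₁⟩, rfl, ?_⟩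
    show ν.toFun default (u, v₀) = ν.toFun (DiscreteIndex.mk.symm (DiscreteIndex.mk default))
      (u, ‖v₀‖ • (radialProjection (spherePt l) v₀ : 𝔼 (l + 1)))
    rw [norm_smul_coe_radialProjection]
    rfl
  let c₀ : ↥(ballTimesSphere ι k l) := ⟨(DiscreteIndex.mk default,
    ((0 : 𝔼 (k + 1)), radialProjection (spherePt l) v₀)), by simp⟩
  have hb : b.Homotopic (ContinuousMap.const _ c₀) := ⟨
    { toFun := fun p ↦ ⟨(DiscreteIndex.mk default,
        (((1 - (p.1 : ℝ)) * ‖v₀‖) • (p.2 : 𝔼 (k + 1)), radialProjection (spherePt l) v₀)), by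
          have h0 : 0 ≤ 1 - (p.1 : ℝ) := by have := p.1.2.2; linarith
          have h1 : 1 - (p.1 : ℝ) ≤ 1 := by have := p.1.2.1; linarith
          rw [mem_ballTimesSphere_iff, norm_smul_coe_sphere (mul_nonneg h0 (norm_nonneg _))]
          calc (1 - (p.1 : ℝ)) * ‖v₀‖ ≤ 1 * ‖v₀‖ := by gcongr
            _ < 1 := by rw [one_mul]; exact hv₁⟩
      continuous_toFun := by
        have h1 : Continuous fun p : unitInterval × (𝕊 k) ↦
            ((1 - (p.1 : ℝ)) * ‖v₀‖) • (p.2 : 𝔼 (k + 1)) := by fun_prop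
        have h2 : Continuous fun p : unitInterval × (𝕊 k) ↦
            (DiscreteIndex.mk (default : ι), (((1 - (p.1 : ℝ)) * ‖v₀‖) • (p.2 : 𝔼 (k + 1)),
              radialProjection (spherePt l) v₀)) :=
          Continuous.prodMk continuous_const (Continuous.prodMk h1 continuous_const)
        exact h2.subtype_mk _
      map_zero_left := fun u ↦ by
        apply Subtype.ext
        simp [b]
      map_one_left := fun u ↦ by
        apply Subtype.ext
        simp [c₀] }⟩
  rw [hfac]
  exact map_eq_zero_of_homotopic_const R M _ (jB c₀)
    ((ContinuousMap.Homotopic.refl (⟨jB, hBc⟩ : C(_, P))).comp hb) hn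

end FramedSphereFamily

/-- The topological content of an open gluing (`IsOpenGluingWith`): both gluing maps are open
embeddings. [folklore] -/
theorem IsOpenGluingWith.isOpenEmbedding_left_right {EA HA EB HB EP HP : Type*}
    [NormedAddCommGroup EA] [NormedSpace ℝ EA] [TopologicalSpace HA] [NormedAddCommGroup EB]
    [NormedSpace ℝ EB] [TopologicalSpace HB] [NormedAddCommGroup EP] [NormedSpace ℝ EP]
    [TopologicalSpace HP] {IA : ModelWithCorners ℝ EA HA} {IB : ModelWithCorners ℝ EB HB}
    {IP : ModelWithCorners ℝ EP HP} {A : Type*} [TopologicalSpace A] [ChartedSpace HA A]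
    {B : Type*} [TopologicalSpace B] [ChartedSpace HB B] {Q : Type*} [TopologicalSpace Q]
    [ChartedSpace HP Q] {Rel : A → B → Prop} {jA : A → Q} {jB : B → Q}
    (h : IsOpenGluingWith IA IB IP Rel jA jB) : IsOpenEmbedding jA ∧ IsOpenEmbedding jB :=
  ⟨⟨h.1.isEmbedding, h.2.1⟩, ⟨h.2.2.1.isEmbedding, h.2.2.2.1⟩⟩

end Gluing

end Literature.Topology.FourManifolds
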